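import Summits.FinalStateConjecture.FinalStateConjecture.Theorems.KerrShieldedDataExist.Negative.BentSliceConormal
import Literature.Geometry.Lorentzian.KerrHyperboloidalLeaves
import HarnessLib

/-!
# `KerrShieldedDataExist` — the slice clause of the crux holds for every sub-extremal Kerr (part 5)

Support lemmas for crux `stmt-FinalStateConjecture-10055` (route SwallowTheDatum; standing disprover, gen 3).
Conjuncts 8–9 of the crux ask that the PINNED immersion `ψ = Negative.graph M a r₁`
(`y ↦ (T_{M,a}(r(y)), y)`, part 3 `psi_eq_graph`) be a spacelike immersion of `Kerr.slice a r₁` into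
`(Kerr.region a r₁, Kerr.smoothMetric M a r₁)` carrying a future unit normal for `Kerr.timeOrientation`.
Parts 3–4 certified the deciding scalar inequality; this file DISCHARGES the two conjuncts outright, for
every `|a| < M` and EVERY inner radius `r₁`, by identifying the graph with a leaf embedding
`Kerr.leafEmbed a r₁ h 0` of the tree's hyperboloidal-leaf calculus (`KerrHyperboloidalLeaves.lean`,
there specialised to the exterior `r₀ = r₊`) with height `h = bentHeight M a ∘ r`:

* `contDiffAt_bentHeight` (`T_{M,a}` is `C^∞` on `ℝ`: locally `0` below `4M`, a smooth product above `r₊ < 4M`),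
  `hasFDerivAt_bentHeightFun` (`dh = T′(r) dr`, chain rule with `Kerr.hasFDerivAt_radius_slice`);
* `graph_eq_leafEmbed`; the raw normal `N = −g♯(dt* − dh)` (`Kerr.coSharp`) has
  `g(N, N) = (−Σ + T′²(r²+a²) − 2Mr(1+T′)²)/Σ < 0` (`Kerr.leafConormal_coSharp_of_radial` + part 3's
  `conormalForm_bentSlope_neg` at latitude `0` + `r² ≤ Σ`), `g(V, N) = −(1 + 2H(1+T′)) < 0`, and
  `g(N, dψ v) = 0`;
* **`isSpacelikeImmersion_graph`**: `(Kerr.smoothMetric M a r₁).IsSpacelikeImmersion 𝓘(ℝ, E3) (graph M a r₁)`;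
* **`isFutureUnitNormal_graphNormal`**: the normalised `ν = N/√(−g(N,N))` is a future unit normal of the graph
  for `(Kerr.timeOrientation M a r₁ hM).ofLE le_top`; packaged as **`sliceClause_graph`** (both conjuncts, verbatim
  in the crux's form, with `∃ ν`).

Consequences for the lines (crux-plan skeletons in `Cruxes/KerrShieldedDataExist/Lines/`):
`PlugTheSecondSheet.stub_sliceClause` is the case `a = 0` of `sliceClause_graph`; the slice parts of
`NullGlue….stub_bentLeafPatching` and of `stub_harvest` are this theorem at general `(m, a, r₃)`. What the crux
still needs beyond this file is only conjuncts 1, 6, 10–11 (an admissible vacuum datum on `E3` that IS the bent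
slice outside a compact set) — the analytic content (interior gluing), as recorded in the disprover's work file.
-/

noncomputable section

open Real Set Filter
open scoped Manifold ContDiff Topology
open Literature.Geometry.Lorentzian

namespace Summit.FinalStateConjecture.FinalStateConjecture.Theorems.KerrShieldedDataExist.Negative

/-! ## Smoothness of the hard-coded height -/

section Smoothness

variable {M a : ℝ}

/-- **`T_{M,a}` is `C^∞` on all of `ℝ`**: on `r < 4M` it is locally the constant `0`
(`bentHeight_eq_zero_of_le`), on `r > r₊` (which contains `[4M, ∞)` since `r₊ < 4M`) it is a product
of `Real.smoothTransition ∘ affine` with logarithms of positive arguments. [folklore] -/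
theorem contDiffAt_bentHeight (h : |a| < M) (r : ℝ) : ContDiffAt ℝ ∞ (bentHeight M a) r := by
  have hM := mass_pos h
  rcases lt_or_ge r (4 * M) with hr | hr
  · have hev : bentHeight M a =ᶠ[𝓝 r] fun _ => (0 : ℝ) := by
      filter_upwards [Iio_mem_nhds hr] with y hy
      exact bentHeight_eq_zero_of_le hM hy.le
    exact (contDiffAt_const (c := (0 : ℝ))).congr_of_eventuallyEq hev
  · have hrp : Kerr.rPlus M a < r := (rPlus_lt_four_mul h).trans_le hr
    have hrm : Kerr.rMinus M a < r := (rMinus_lt_rPlus h).trans hrp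
    have h1 : ContDiffAt ℝ ∞ (fun y : ℝ => Real.smoothTransition (y / (4 * M) - 1)) r :=
      Real.smoothTransition.contDiff.contDiffAt.comp r
        ((contDiffAt_id.div_const (4 * M)).sub contDiffAt_const)
    have h2 : ContDiffAt ℝ ∞ (fun y : ℝ => Real.log (y - Kerr.rPlus M a)) r :=
      (Real.contDiffAt_log.2 (sub_pos.2 hrp).ne').comp r (contDiffAt_id.sub contDiffAt_const)
    have h3 : ContDiffAt ℝ ∞ (fun y : ℝ => Real.log (y - Kerr.rMinus M a)) r :=
      (Real.contDiffAt_log.2 (sub_pos.2 hrm).ne').comp r (contDiffAt_id.sub contDiffAt_const)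
    have h4 : ContDiffAt ℝ ∞ (blHeight M a) r := by
      unfold blHeight
      exact contDiffAt_const.mul ((contDiffAt_const.mul h2).sub (contDiffAt_const.mul h3))
    unfold bentHeight
    exact h1.mul (h4.sub contDiffAt_const)

variable (M a) in
/-- The crux's height as a function on the Kerr–Schild slice coordinates: `h(y) = T_{M,a}(r(0, y))`. [folklore] -/
def bentHeightFun : E3 → ℝ := fun y => bentHeight M a (Kerr.radius a (E4.ofTimeSpace 0 y))

/-- `h` is `C^∞` wherever `r > 0`. [folklore] -/
theorem contDiffAt_bentHeightFun (h : |a| < M) {y : E3} (hr : 0 < Kerr.radius a (E4.ofTimeSpace 0 y)) :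
    ContDiffAt ℝ ∞ (bentHeightFun M a) y :=
  (contDiffAt_bentHeight h _).comp y (Kerr.contDiffAt_radius_slice hr)

/-- **`dh_y = T′(r) dr_y`** (chain rule with `Kerr.hasFDerivAt_radius_slice`). [folklore] -/
theorem hasFDerivAt_bentHeightFun (h : |a| < M) {y : E3} (hr : 0 < Kerr.radius a (E4.ofTimeSpace 0 y)) :
    HasFDerivAt (bentHeightFun M a)
      (bentSlope M a (Kerr.radius a (E4.ofTimeSpace 0 y)) • Kerr.radiusGrad a y) y :=
  (hasDerivAt_bentHeight h _).comp_hasFDerivAt y (Kerr.hasFDerivAt_radius_slice hr)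

/-- `fderiv h y = T′(r) • dr` in the form used by `Kerr.leafConormal_*_of_radial`. [folklore] -/
theorem fderiv_bentHeightFun (h : |a| < M) {y : E3} (hr : 0 < Kerr.radius a (E4.ofTimeSpace 0 y)) :
    fderiv ℝ (bentHeightFun M a) y = bentSlope M a (Kerr.radius a (E4.ofTimeSpace 0 y)) • Kerr.radiusGrad a y :=
  (hasFDerivAt_bentHeightFun h hr).fderiv

end Smoothness

/-! ## The graph is a leaf embedding; its raw normal -/

section Normal

variable {M a r₁ : ℝ}

/-- Points of the slice have `r > 0`. [folklore] -/
theorem radius_pos_of_slice (y : Kerr.slice a r₁) : 0 < Kerr.radius a (E4.ofTimeSpace 0 (y : E3)) :=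
  (le_max_right _ _).trans_lt (Kerr.mem_slice.1 y.2)

/-- **The crux's graph is the leaf embedding of height `h = T ∘ r` at `τ = 0`.** [folklore] -/
theorem graph_eq_leafEmbed (M a r₁ : ℝ) : graph M a r₁ = Kerr.leafEmbed a r₁ (bentHeightFun M a) 0 := by
  funext y
  apply Subtype.ext
  rw [coe_graph, Kerr.coe_leafEmbed, zero_add]
  rfl

/-- The graph point over `y` is `(h y, y)`. [folklore] -/
theorem coe_graph_eq (y : Kerr.slice a r₁) :
    (graph M a r₁ y : E4) = E4.ofTimeSpace (bentHeightFun M a y) y := rfl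

variable (M a r₁) in
/-- The **raw (un-normalised) normal** `N = −g♯(dt* − dh)` of the graph at the point over `y`, written with
the explicit inverse Kerr–Schild metric `Kerr.coSharp`. [cite: arXiv08110354, §5.1] -/
def rawNormal (y : Kerr.slice a r₁) : E4 :=
  -Kerr.coSharp M a (graph M a r₁ y : E4) (Kerr.leafConormal (bentHeightFun M a) (graph M a r₁ y : E4))

/-- `g(N, w) = −(dt* − dh)(w)`. [folklore] -/
theorem bilin_rawNormal (y : Kerr.slice a r₁) (w : E4) :
    Kerr.bilin M a (graph M a r₁ y : E4) (rawNormal M a r₁ y) w =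
      -Kerr.leafConormal (bentHeightFun M a) (graph M a r₁ y : E4) w := by
  have hx : 0 < Kerr.radius a (graph M a r₁ y : E4) := Kerr.radius_pos_of_mem_region (graph M a r₁ y).2
  rw [rawNormal, (Kerr.bilin M a _).map_neg, neg_apply, Kerr.bilin_coSharp M a hx]

/-- **`g(N, N) = (−Σ + T′²(r² + a²) − 2Mr(1 + T′)²)/Σ`** (`Kerr.leafConormal_coSharp_of_radial`). [cite: arXiv08110354, §5.1] -/
theorem bilin_rawNormal_self (h : |a| < M) (y : Kerr.slice a r₁) :
    Kerr.bilin M a (graph M a r₁ y : E4) (rawNormal M a r₁ y) (rawNormal M a r₁ y) =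
      (-Kerr.blSigma a y + bentSlope M a (Kerr.radius a (E4.ofTimeSpace 0 (y : E3))) ^ 2 *
          (Kerr.radius a (E4.ofTimeSpace 0 (y : E3)) ^ 2 + a ^ 2) -
        2 * M * Kerr.radius a (E4.ofTimeSpace 0 (y : E3)) *
          (1 + bentSlope M a (Kerr.radius a (E4.ofTimeSpace 0 (y : E3)))) ^ 2) / Kerr.blSigma a y := by
  have hr := radius_pos_of_slice y
  have hx : 0 < Kerr.radius a (graph M a r₁ y : E4) := Kerr.radius_pos_of_mem_region (graph M a r₁ y).2
  rw [rawNormal, E4.bilin_neg_neg, Kerr.bilin_coSharp M a hx, coe_graph_eq]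
  exact Kerr.leafConormal_coSharp_of_radial (fderiv_bentHeightFun h hr) hr

/-- **The raw normal is timelike** at every point of the slice, for every `|a| < M` and every `r₁`:
numerator `≤ −r² + P(T′) = conormalForm M a r 0 T′ < 0` (`r² ≤ Σ`, part 3). [cite: arXiv08110354, §5.1] -/
theorem bilin_rawNormal_self_neg (h : |a| < M) (y : Kerr.slice a r₁) :
    Kerr.bilin M a (graph M a r₁ y : E4) (rawNormal M a r₁ y) (rawNormal M a r₁ y) < 0 := by
  have hr := radius_pos_of_slice y
  have hS := Kerr.blSigma_pos hr
  have hle := Kerr.sq_le_blSigma hr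
  have hneg := conormalForm_bentSlope_neg h hr 0
  rw [bilin_rawNormal_self h y]
  apply div_neg_of_neg_of_pos _ hS
  unfold conormalForm at hneg
  nlinarith

/-- **`g(V, N) = −(1 + 2H(1 + T′)) < 0`**: the raw normal lies in the cone of the orienting field
`V = Kerr.timeVector`. [cite: arXiv08110354, §5.1] -/
theorem bilin_timeVector_rawNormal_neg (h : |a| < M) (y : Kerr.slice a r₁) :
    Kerr.bilin M a (graph M a r₁ y : E4) (Kerr.timeVector M a (graph M a r₁ y : E4)) (rawNormal M a r₁ y) < 0 := by
  have hr := radius_pos_of_slice y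
  rw [Kerr.bilin_symm, bilin_rawNormal, coe_graph_eq,
    Kerr.leafConormal_timeVector_of_radial (fderiv_bentHeightFun h hr) hr]
  have hH := Kerr.scalarH_nonneg (mass_pos h).le a (E4.ofTimeSpace (bentHeightFun M a y) y)
  have ht := bentSlope_nonneg h (Kerr.radius a (E4.ofTimeSpace 0 (y : E3)))
  nlinarith

/-- **The differential of the graph**: `dψ_y v = (dh_y v, v)`. [folklore] -/
theorem hasMFDerivAt_graph (h : |a| < M) (y : Kerr.slice a r₁) :
    HasMFDerivAt 𝓘(ℝ, E3) 𝓘(ℝ, E4) (graph M a r₁) y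
      ((fderiv ℝ (bentHeightFun M a) y).smulRight (E4.basisVector 0) + E4.spaceEmbed) := by
  rw [graph_eq_leafEmbed]
  exact Kerr.hasMFDerivAt_leafEmbed ((contDiffAt_bentHeightFun h (radius_pos_of_slice y)).differentiableAt
    (by simp)).hasFDerivAt

/-- **`N ⊥ (dh v, v)`**: the raw normal annihilates the lifted tangent vectors of the graph. [folklore] -/
theorem bilin_rawNormal_lift (y : Kerr.slice a r₁) (v : E3) :
    Kerr.bilin M a (graph M a r₁ y : E4) (rawNormal M a r₁ y)
      (E4.ofTimeSpace (fderiv ℝ (bentHeightFun M a) y v) v) = 0 := by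
  rw [bilin_rawNormal, neg_eq_zero, coe_graph_eq]
  have key := Kerr.leafConormal_tangent (bentHeightFun M a) 0 (y : E3) v
  rwa [Kerr.leafPoint, zero_add] at key

/-- **`N ⊥ dψ v`**: the raw normal annihilates the tangent vectors of the graph. [folklore] -/
theorem bilin_rawNormal_mfderiv (h : |a| < M) (y : Kerr.slice a r₁) (v : E3) :
    Kerr.bilin M a (graph M a r₁ y : E4) (rawNormal M a r₁ y) (mfderiv 𝓘(ℝ, E3) 𝓘(ℝ, E4) (graph M a r₁) y v) = 0 := by
  have hgoal : Kerr.bilin M a (graph M a r₁ y : E4) (rawNormal M a r₁ y)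
      (((fderiv ℝ (bentHeightFun M a) (y : E3)).smulRight (E4.basisVector 0) + E4.spaceEmbed) v) = 0 := by
    rw [E4.smulRight_add_spaceEmbed_apply]
    exact bilin_rawNormal_lift y v
  rw [(hasMFDerivAt_graph h y).mfderiv]
  exact hgoal

end Normal

/-! ## The two conjuncts of the crux -/

section SliceClause

variable {M a r₁ : ℝ}

/-- **Conjunct 8: the pinned immersion is a spacelike immersion**, for every `|a| < M` and every inner radius
`r₁` (tangent vectors are `g`-orthogonal to the timelike raw normal, hence spacelike, O'Neill Lemma 5.26; the
graph is `C^∞` by `contDiffAt_bentHeightFun`). [cite: ONeill1983, Ch. 5 Lemma 5.26] -/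
theorem isSpacelikeImmersion_graph [Kerr.Facts] (h : |a| < M) (r₁ : ℝ) :
    (Kerr.smoothMetric M a r₁).IsSpacelikeImmersion 𝓘(ℝ, E3) (graph M a r₁) := by
  refine ⟨?_, fun y v hv => ?_⟩
  · rw [graph_eq_leafEmbed]
    exact Kerr.contMDiff_leafEmbed fun y => contDiffAt_bentHeightFun h (radius_pos_of_slice y)
  rw [PseudoRiemannianMetric.inducedBilin_apply, (hasMFDerivAt_graph h y).mfderiv, Kerr.smoothMetric_val]
  set w : E3 := v with hw
  have hw0 : w ≠ 0 := hv
  have htl : (Kerr.smoothMetric M a r₁).IsTimelike (x := graph M a r₁ y) (rawNormal M a r₁ y) := by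
    rw [LorentzianMetric.isTimelike_iff, Kerr.smoothMetric_val]
    exact bilin_rawNormal_self_neg h y
  have horth : (Kerr.smoothMetric M a r₁).val (graph M a r₁ y) (rawNormal M a r₁ y)
      (E4.ofTimeSpace (fderiv ℝ (bentHeightFun M a) y w) w) = 0 := by
    rw [Kerr.smoothMetric_val]; exact bilin_rawNormal_lift y w
  rcases (Kerr.smoothMetric M a r₁).isSpacelike_of_orthogonal htl horth with hpos | hzero
  · rw [Kerr.smoothMetric_val] at hpos
    have hgoal : 0 < Kerr.bilin M a (graph M a r₁ y : E4)
        (((fderiv ℝ (bentHeightFun M a) (y : E3)).smulRight (E4.basisVector 0) + E4.spaceEmbed) w)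
        (((fderiv ℝ (bentHeightFun M a) (y : E3)).smulRight (E4.basisVector 0) + E4.spaceEmbed) w) := by
      rw [E4.smulRight_add_spaceEmbed_apply]
      exact hpos
    exact hgoal
  · exfalso
    apply hw0
    have h0 : E4.ofTimeSpace (fderiv ℝ (bentHeightFun M a) y w) w = (0 : E4) := hzero
    simpa using congrArg E4.spatial h0

variable (M a r₁) in
/-- The **future unit normal** of the graph: `ν = N/√(−g(N, N))`. [cite: arXiv08110354, §5.1] -/
def graphNormal (y : Kerr.slice a r₁) : E4 :=
  (Real.sqrt (-Kerr.bilin M a (graph M a r₁ y : E4) (rawNormal M a r₁ y) (rawNormal M a r₁ y)))⁻¹ •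
    rawNormal M a r₁ y

/-- `g(ν, ν) = −1`. [folklore] -/
theorem bilin_graphNormal_self (h : |a| < M) (y : Kerr.slice a r₁) :
    Kerr.bilin M a (graph M a r₁ y : E4) (graphNormal M a r₁ y) (graphNormal M a r₁ y) = -1 := by
  have hN := bilin_rawNormal_self_neg h y
  set q := Kerr.bilin M a (graph M a r₁ y : E4) (rawNormal M a r₁ y) (rawNormal M a r₁ y) with hq
  have hq0 : -q ≠ 0 := by linarith
  have hs2 : Real.sqrt (-q) ^ 2 = -q := Real.sq_sqrt (by linarith)
  have key : (Real.sqrt (-q))⁻¹ * ((Real.sqrt (-q))⁻¹ * q) = -1 := by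
    rw [← mul_assoc, ← pow_two, inv_pow, hs2, inv_mul_eq_div, div_neg, div_self hN.ne]
  simp only [graphNormal, map_smul, smul_apply, smul_eq_mul]
  exact key

/-- `ν ⊥ dψ v`. [folklore] -/
theorem bilin_graphNormal_mfderiv (h : |a| < M) (y : Kerr.slice a r₁) (v : E3) :
    Kerr.bilin M a (graph M a r₁ y : E4) (graphNormal M a r₁ y) (mfderiv 𝓘(ℝ, E3) 𝓘(ℝ, E4) (graph M a r₁) y v) = 0 := by
  simp only [graphNormal, map_smul, smul_apply, smul_eq_mul, bilin_rawNormal_mfderiv h y v,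
    mul_zero]

/-- `g(V, ν) < 0`. [folklore] -/
theorem bilin_timeVector_graphNormal_neg (h : |a| < M) (y : Kerr.slice a r₁) :
    Kerr.bilin M a (graph M a r₁ y : E4) (Kerr.timeVector M a (graph M a r₁ y : E4)) (graphNormal M a r₁ y) < 0 := by
  have hN := bilin_rawNormal_self_neg h y
  have hs : 0 < Real.sqrt (-Kerr.bilin M a (graph M a r₁ y : E4) (rawNormal M a r₁ y) (rawNormal M a r₁ y)) :=
    Real.sqrt_pos.2 (by linarith)
  rw [graphNormal, map_smul, smul_eq_mul]
  exact mul_neg_of_pos_of_neg (inv_pos.2 hs) (bilin_timeVector_rawNormal_neg h y)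

/-- **Conjunct 9: `ν` is a future unit normal of the pinned immersion** for the Kerr time orientation
(`0 ≤ M` is the orientation's own hypothesis; `|a| < M` gives it). [cite: Wald1984, §10.2] -/
theorem isFutureUnitNormal_graphNormal [Kerr.Facts] (h : |a| < M) (r₁ : ℝ) (hM : 0 ≤ M) :
    (Kerr.smoothMetric M a r₁).IsFutureUnitNormal 𝓘(ℝ, E3) ((Kerr.timeOrientation M a r₁ hM).ofLE le_top)
      (graph M a r₁) (graphNormal M a r₁) := by
  refine ⟨⟨fun y v => ?_, fun y => ?_⟩, fun y => ⟨?_, ?_⟩⟩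
  · rw [Kerr.smoothMetric_val]; exact bilin_graphNormal_mfderiv h y v
  · rw [Kerr.smoothMetric_val]; exact bilin_graphNormal_self h y
  · refine ⟨?_, ?_⟩
    · have h1 := bilin_graphNormal_self h y
      rw [Kerr.smoothMetric_val]
      exact (show Kerr.bilin M a (graph M a r₁ y : E4) (graphNormal M a r₁ y) (graphNormal M a r₁ y) ≤ 0 by
        rw [h1]; norm_num)
    · intro h0
      have h1 := bilin_graphNormal_self h y
      have h2 : Kerr.bilin M a (graph M a r₁ y : E4) (graphNormal M a r₁ y) (graphNormal M a r₁ y) = 0 := by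
        rw [show graphNormal M a r₁ y = (0 : E4) from h0]; simp
      linarith
  · rw [TimeOrientation.vectorField_ofLE, Kerr.smoothMetric_val]
    exact bilin_timeVector_graphNormal_neg h y

/-- **THE SLICE CLAUSE OF THE CRUX** (conjuncts 8 and 9, verbatim in the crux's form, for the pinned `ψ`):
for every sub-extremal `(M, a)`, every inner radius `r₁` and the orientation hypothesis `hM`,
`ψ = graph M a r₁` is a spacelike immersion and has a future unit normal. In particular
`PlugTheSecondSheet.stub_sliceClause` (the case `a = 0`) and the slice parts of `stub_harvest` /
`NullGlue….stub_bentLeafPatching` hold. [cite: arXiv08110354, §5.1] [cite: Cook2000, §3.2.2] -/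
theorem sliceClause_graph [Kerr.Facts] (h : |a| < M) (r₁ : ℝ) (hM : 0 ≤ M) :
    (Kerr.smoothMetric M a r₁).IsSpacelikeImmersion 𝓘(ℝ, E3) (graph M a r₁) ∧
      ∃ ν : NormalField 𝓘(ℝ, E4) (graph M a r₁),
        (Kerr.smoothMetric M a r₁).IsFutureUnitNormal 𝓘(ℝ, E3) ((Kerr.timeOrientation M a r₁ hM).ofLE le_top)
          (graph M a r₁) ν :=
  ⟨isSpacelikeImmersion_graph h r₁, graphNormal M a r₁, isFutureUnitNormal_graphNormal h r₁ hM⟩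

/-- The `a = 0` form consumed by `Lines/plug-the-second-sheet.lean` (`stub_sliceClause`, whose extra
hypothesis `0 < r₁` is not needed). [cite: arXiv08110354, §5.1] -/
theorem sliceClause_graph_zero_spin [Kerr.Facts] (M r₁ : ℝ) (hM : 0 ≤ M) (hM' : 0 < M) :
    (Kerr.smoothMetric M 0 r₁).IsSpacelikeImmersion 𝓘(ℝ, E3) (graph M 0 r₁) ∧
      ∃ ν : NormalField 𝓘(ℝ, E4) (graph M 0 r₁),
        (Kerr.smoothMetric M 0 r₁).IsFutureUnitNormal 𝓘(ℝ, E3) ((Kerr.timeOrientation M 0 r₁ hM).ofLE le_top)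
          (graph M 0 r₁) ν :=
  sliceClause_graph (by simpa using hM') r₁ hM

end SliceClause

end Summit.FinalStateConjecture.FinalStateConjecture.Theorems.KerrShieldedDataExist.Negative

end
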